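import Literature.AlgebraicGeometry.HodgeTheory.BettiHypersurfaceOffMiddleBettiNumbersPicardNumberOne
import Literature.AlgebraicGeometry.HodgeTheory.BettiArithmeticGenus
import Literature.AlgebraicGeometry.HodgeTheory.BettiEulerCharacteristicProducts
import HarnessLib

/-!
# Off the middle degree a smooth hypersurface `Y ⊂ ℙ^{m+1}_ℂ` is of Hodge–Tate type (`h^{p,q}(HᵏY) = 0`, `k ≠ m`, `p ≠ q`; no holomorphic `k`-forms for `0 < k ≠ m`); the
# HODGE-THEORETIC arithmetic genus `χ(𝒪_Y) = Σ_k (−1)ᵏ h^{k,0}(Y) = 1 + (−1)^m C(d−1, m+1)`, `p_a(Y) = C(d−1, m+1)`; holomorphic forms, irregularity, geometric genus and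
# arithmetic genus of a product `Y × Z` with any smooth projective `Z`
# (Hartshorne I Ex. 7.2 (c), (e), III Ex. 5.3, 5.5; Arapura (17.3.1); Voisin II Cor. 1.24–1.25; Hirzebruch 0.1)

Family `hodge`, lane `lit-hodgefound` (Track 2 foundations library; Layers A1/A4), layer `Literature/AlgebraicGeometry/HodgeTheory`.  THEOREMS ONLY (no definition, no named fact,
no instance, no notation; D-0026 net debt `0`).  Prover seat `lit-hodgefound-p21` (generation 41, row g41-#7), sequel of the seat's g41-#1 `BettiHypersurfaceGeometricGenusFanoProducts`
(`IsSmoothHypersurface.hodgeNumber_hodge_top_zero_eq_choose`: `h^{m,0}(Y) = C(d−1, m+1)` for an ABSTRACT smooth hypersurface `IsSmoothHypersurface m d Y`), g41-#2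
`BettiHypersurfaceMiddleBettiNumberClosedFormSurfaceDiamond` (`…hodgeNumber_hodge_eq_zero_of_odd`) and g41-#5 `BettiHypersurfaceOffMiddleBettiNumbersPicardNumberOne`; it uses the tree's
`BettiHodgeConjectureProductsOffMiddleAlgebraicFactor` (`IsSmoothHypersurface.hodgeClasses_hodge_eq_top_of_two_mul_ne`), `BettiArithmeticGenus` (`BettiUniverse.arithGenus_tensor`: `χ(Y × Z) = χ(Y) χ(Z)` with
`χ = Σ_{k ≤ dim} (−1)ᵏ h^{k,0}(Hᵏ)` written out — the lane has no `arithGenus` definition and none is introduced), `BettiHodgeNumbersKunneth` (`BettiUniverse.hodgeNumber_hodge_tensor_fst_zero`,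
`…_tensor_top_zero`) and `BettiEulerCharacteristicProducts` (`BettiUniverse.hodgeNumber_hodge_one_tensor`: `q` is additive).  The tree's `ProjectiveHypersurfaceHilbertPolynomial.arithGenus_hypersurface`
is the HILBERT-POLYNOMIAL / Čech statement `p_a(H) = C(d−1, r)`; §2 here is the Hodge-number statement on the lane's carriers `Hᵏ(Y) = BettiUniverse.hodge` (the two agree by Dolbeault and Serre
duality, which the lane does not have; neither statement is derived from the other here).

THE MATHEMATICS.  (§1) Let `Y ⊂ ℙ^{m+1}_ℂ` be a smooth hypersurface of degree `d`, `dim Y = m`.  By the Lefschetz hyperplane theorem and Poincaré duality (Cor. 1.24–1.25) `b_k(Y) = 0` for odd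
`k ≠ m` and `H^{2c}(Y;ℚ) = ℚ η^c` for `2c ≠ m`, a line of algebraic, hence Hodge, classes; a weight-`2c` Hodge structure all of whose rational vectors are Hodge classes is purely of type `(c,c)`
(Prop. 11.20).  Hence **`h^{p,q}(Hᵏ(Y)) = 0` whenever `k ≠ m` and `p ≠ q`**; in particular **`h^{k,0}(Y) = h^{0,k}(Y) = 0` for `0 < k ≠ m`** (`H⁰(Y, Ωᵏ) = 0`, `Hᵏ(Y, 𝒪_Y) = 0` for `0 < k < m`:
Hartshorne's Exercise III.5.5 (c)).  (§2) With `h^{0,0} = 1` and `h^{m,0}(Y) = C(d−1, m+1)` ((17.3.1), g41-#1) the alternating sum has two terms: **`χ(𝒪_Y) := Σ_{k ≤ m} (−1)ᵏ h^{k,0}(Hᵏ(Y)) =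
1 + (−1)^m C(d−1, m+1)`**, i.e. **`p_a(Y) = (−1)^m (χ − 1) = C(d−1, m+1)`** — Hartshorne's Exercise I.7.2 (c) «if `H` is a hypersurface of degree `d` in `ℙⁿ`, then `p_a(H) = C(d−1, n)`» read
with `n = m + 1` and III.5.5 (d) `p_a(Y) = dim H^q(Y, 𝒪_Y)`.  Instances: `d ≤ m + 1` (Fano or `K_Y = 0`-borderline excluded) `χ = 1`; `d = m + 2` (Calabi–Yau) `χ = 1 + (−1)^m` (`0` for the quintic
threefold, `2` for the quartic surface); surfaces `S_d ⊂ ℙ³`: `χ(𝒪_{S_d}) = 1 + C(d−1, 3)`; cubics of dimension `≥ 2`: `1`.  (§3) For any smooth projective `Z` of dimension `n` and any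
smooth-projective structure on `Y × Z`, Künneth for `h^{k,0}` (`h^{k,0}(Y × Z) = Σ_i h^{i,0}(Y) h^{k−i,0}(Z)`, Thm. 11.38) collapses: **`h^{k,0}(Y × Z) = h^{k,0}(Z)` for `k < m`** and
**`= h^{k,0}(Z) + C(d−1, m+1) · h^{k−m,0}(Z)` for `k ≥ m`**; so **`p_g(Y × Z) = C(d−1, m+1) · p_g(Z)`** (`0` for `d ≤ m + 1`, `p_g(Z)` for `d = m + 2`; Hartshorne II Ex. 8.3: `p_g` is multiplicative),
**`q(Y × Z) = q(Z)`** (`m ≥ 2`), **`h^{2,0}(Y × Z) = h^{2,0}(Z)`** (`m ≥ 3`), `h^{2,0}(S_d × Z) = C(d−1, 3) + h^{2,0}(Z)`; and **`χ(Y × Z) = (1 + (−1)^m C(d−1, m+1)) · χ(Z)`** (Hirzebruch: «the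
arithmetic genus … behave[s] multiplicatively»), `= χ(Z)` for `d ≤ m + 1`, Hartshorne's I.7.2 (e) **`p_a(Y × Z) = p_a(Y) p_a(Z) + (−1)ⁿ p_a(Y) + (−1)^m p_a(Z)`** with `p_a(Y) = C(d−1, m+1)`, and for
two hypersurfaces `χ(Y × Y′) = (1 + (−1)^m C(d−1, m+1))(1 + (−1)^{m′} C(d′−1, m′+1))`, `p_g(Y × Y′) = C(d−1, m+1) C(d′−1, m′+1)`.

THE PRINTS.  R. Hartshorne (1977) [Hartshorne1977] I Exercise 7.2 (c), (e) (PDF p. 73–74); II Exercise 8.3 (b)–(c) (PDF p. 239); III Exercise 5.3 (PDF p. 287), Exercise 5.5 (c)–(d) (PDF p. 288).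
D. Arapura (2012) [Arapura2012] §17.3 (17.3.1), Cor. 17.3.5 (PDF p. 249); §11.1 Example 11.1.2 (PDF p. 174).  C. Voisin (2003) [VoisinHodgeII2003] §1.2.3 Cor. 1.24–1.25 (PDF p. 62).  C. Voisin (2002)
[VoisinHodgeI2002] §7.1.1; §11.1.2 Prop. 11.20; §11.3.3 Thm. 11.38 (PDF p. 236).  F. Hirzebruch (1966) [Hirzebruch1966] Introduction 0.1.  D. Huybrechts (2016) [Huybrechts2016K3] Ch. 1 §2.3.
No new mathematics is claimed.

THE OBJECTS (all the tree's).  `Hᵏ(X) = BettiUniverse.hodge hHD hX k`, `HodgeStructure.hodgeNumber`, `hodgeClasses`, `HodgeStructure.hodgeNumber_eq_zero_of_hodgeClasses_eq_top`, `BettiUniverse.finite`,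
`BettiUniverse.hodgeNumber_hodge_zero_zero`, `BettiUniverse.hodgeNumber_hodge_eq_zero_of_lt_fst`, `BettiUniverse.hodgeNumber_hodge_tensor_fst_zero`, `BettiUniverse.hodgeNumber_hodge_tensor_top_zero`,
`BettiUniverse.hodgeNumber_hodge_one_tensor`, `BettiUniverse.arithGenus_tensor`, `IsSmoothHypersurface.hodgeClasses_hodge_eq_top_of_two_mul_ne`, `IsSmoothHypersurface.hodgeNumber_hodge_eq_zero_of_odd`,
`IsSmoothHypersurface.hodgeNumber_hodge_top_zero_eq_choose`, `hodgeTensorFacts_holds`.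

WHAT IS PROVED.
* §1 **`IsSmoothHypersurface.hodgeNumber_hodge_eq_zero_of_ne_middle`** (`h^{p,q}(HᵏY) = 0`, `k ≠ m`, `p ≠ q`), **`…hodgeNumber_hodge_fst_zero_eq_zero_of_ne_middle`** (`h^{k,0} = 0`, `0 < k ≠ m`),
  `…hodgeNumber_hodge_zero_snd_eq_zero_of_ne_middle` (`h^{0,k} = 0`).
* §2 **`IsSmoothHypersurface.arithGenus_eq`** (`χ(𝒪_Y) = 1 + (−1)^m C(d−1, m+1)`), **`…arithGenusSeveri_eq_choose`** (`p_a(Y) = C(d−1, m+1)`), `…arithGenus_eq_one_of_le` (`d ≤ m+1`), `…arithGenus_eq_of_eq_add_two`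
  (`d = m+2`), `…arithGenus_surface`, `…arithGenus_quarticSurface` (`2`), `…arithGenus_quinticThreefold` (`0`), `…arithGenus_cubic_eq_one`.
* §3 **`IsSmoothHypersurface.hodgeNumber_hodge_fst_zero_tensor_of_lt`** (`h^{k,0}(Y × Z) = h^{k,0}(Z)`, `k < m`), **`…_of_le`** (`k ≥ m`), **`…hodgeNumber_hodge_top_zero_tensor`** (`p_g(Y × Z) = C · p_g(Z)`),
  `…_eq_zero_of_le`, `…_of_eq_add_two`, **`…irregularity_tensor`** / `…_right` (`q(Y × Z) = q(Z)`), **`…hodgeNumber_hodge_two_zero_tensor`** (`h^{2,0}(Y × Z) = h^{2,0}(Z)`, `m ≥ 3`),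
  `…hodgeNumber_hodge_two_zero_surface_tensor`, **`…arithGenus_tensor`** (`χ(Y × Z) = (1 + (−1)^m C) χ(Z)`), `…arithGenus_tensor_of_le`, **`…arithGenusSeveri_tensor`** (Hartshorne I.7.2 (e)),
  `…arithGenus_tensor_hypersurface`, `…hodgeNumber_hodge_top_zero_tensor_hypersurface`.

## References
* [Hartshorne1977] R. Hartshorne, *Algebraic Geometry* (1977) — I Exercise 7.2 (c), (e) (PDF p. 73–74); II Exercise 8.3 (b)–(c) (PDF p. 239); III Exercise 5.3 (PDF p. 287), Exercise 5.5 (c)–(d) (PDF p. 288).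
* [Arapura2012] D. Arapura, *Algebraic Geometry over the Complex Numbers* (2012) — §17.3 (17.3.1), Cor. 17.3.5 (PDF p. 249); §11.1 Example 11.1.2 (PDF p. 174).
* [VoisinHodgeII2003] C. Voisin, *Hodge Theory and Complex Algebraic Geometry II* (2003) — §1.2.3 Cor. 1.24–1.25 (PDF p. 62).
* [VoisinHodgeI2002] C. Voisin, *Hodge Theory and Complex Algebraic Geometry I* (2002) — §7.1.1; §11.1.2 Prop. 11.20; §11.3.3 Thm. 11.38 (PDF p. 236).
* [Hirzebruch1966] F. Hirzebruch, *Topological Methods in Algebraic Geometry* (1966) — Introduction 0.1.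
* [Huybrechts2016K3] D. Huybrechts, *Lectures on K3 Surfaces* (2016) — Ch. 1 §2.3.

## Provenance
Lane `lit-hodgefound` (Hodge path, Track 2), prover seat `lit-hodgefound-p21` (generation 41), self-proposed row g41-#7 (sequel of g41-#1, g41-#2, g41-#5).
-/

noncomputable section

open scoped TensorProduct
open CategoryTheory MonoidalCategory Module Finset
open Literature.AlgebraicTopology.SingularHomology

namespace Literature.AlgebraicGeometry.Motives.IsSmoothHypersurface

open Literature.AlgebraicGeometry.Motives
open Literature.AlgebraicGeometry.Motives.HodgeStructure
open Literature.AlgebraicGeometry.HodgeTheory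

variable {m n e d l : ℕ} {X Y Z S : SchemeOver ℂ}

/-! ### §1 Off the middle degree a smooth hypersurface is of Hodge–Tate type: `h^{p,q}(Hᵏ(Y)) = 0` for `k ≠ dim Y`, `p ≠ q`; no holomorphic `k`-forms for `0 < k ≠ dim Y` -/

section OffMiddle

/-- **`h^{p,q}(Hᵏ(Y)) = 0` for `k ≠ m = dim Y` and `p ≠ q`** on a smooth hypersurface `Y ⊂ ℙ^{m+1}_ℂ`: odd `k ≠ m` has `b_k = 0`, even `k = 2c ≠ m` has `H^{2c}(Y;ℚ) = ℚ η^c = Hdg^c` purely of type `(c,c)`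
(Lefschetz hyperplane theorem and Prop. 11.20). [cite: VoisinHodgeII2003, §1.2.3 Cor. 1.24 and Cor. 1.25 (PDF p. 62)] [cite: VoisinHodgeI2002, §7.1.1 and §11.1.2 Prop. 11.20] -/
theorem hodgeNumber_hodge_eq_zero_of_ne_middle (hYh : IsSmoothHypersurface m e Y) (hHD : exists_isReal_hodgeModel) (hX : IsSmoothProjective m Y) {k p q : ℕ} (hkm : k ≠ m) (hpq : p + q = k)
    (hne : p ≠ q) : (BettiUniverse.hodge hHD hX k).hodgeNumber p q = 0 := by
  rcases Nat.even_or_odd k with ⟨c, hc⟩ | hk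
  · obtain rfl : k = 2 * c := by omega
    haveI := BettiUniverse.finite hX (2 * c)
    exact (BettiUniverse.hodge hHD hX (2 * c)).hodgeNumber_eq_zero_of_hodgeClasses_eq_top (p := (c : ℤ)) (by push_cast; ring)
      (hYh.hodgeClasses_hodge_eq_top_of_two_mul_ne hHD hX (p := c) hkm) (p' := (p : ℤ)) (q' := (q : ℤ)) (by
        intro h
        have : p = c := by exact_mod_cast h
        omega)
  · exact hYh.hodgeNumber_hodge_eq_zero_of_odd hHD hX hk hkm hpq

/-- **No holomorphic `k`-forms off the middle: `h^{k,0}(Hᵏ(Y)) = 0` for `0 < k`, `k ≠ dim Y`** (`H⁰(Y, Ωᵏ_Y) = 0`; dually `Hᵏ(Y, 𝒪_Y) = 0` for `0 < k < dim Y`, Hartshorne's Exercise III.5.5 (c)).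
[cite: VoisinHodgeII2003, §1.2.3 Cor. 1.24 and Cor. 1.25 (PDF p. 62)] [cite: Hartshorne1977, III Exercise 5.5 (c) (PDF p. 288)] -/
theorem hodgeNumber_hodge_fst_zero_eq_zero_of_ne_middle (hYh : IsSmoothHypersurface m e Y) (hHD : exists_isReal_hodgeModel) (hX : IsSmoothProjective m Y) {k : ℕ} (hk : 0 < k) (hkm : k ≠ m) :
    (BettiUniverse.hodge hHD hX k).hodgeNumber k 0 = 0 := by
  exact_mod_cast hYh.hodgeNumber_hodge_eq_zero_of_ne_middle hHD hX hkm (p := k) (q := 0) rfl (by omega)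

/-- `h^{0,k}(Hᵏ(Y)) = 0` for `0 < k ≠ dim Y` (`Hᵏ(Y, 𝒪_Y) = 0`). [cite: Hartshorne1977, III Exercise 5.5 (c) (PDF p. 288)] [cite: VoisinHodgeII2003, §1.2.3 Cor. 1.24 and Cor. 1.25 (PDF p. 62)] -/
theorem hodgeNumber_hodge_zero_snd_eq_zero_of_ne_middle (hYh : IsSmoothHypersurface m e Y) (hHD : exists_isReal_hodgeModel) (hX : IsSmoothProjective m Y) {k : ℕ} (hk : 0 < k) (hkm : k ≠ m) :
    (BettiUniverse.hodge hHD hX k).hodgeNumber 0 k = 0 := by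
  exact_mod_cast hYh.hodgeNumber_hodge_eq_zero_of_ne_middle hHD hX hkm (p := 0) (q := k) (by omega) (by omega)

end OffMiddle

/-! ### §2 The arithmetic genus Hodge-theoretically: `χ(𝒪_Y) = Σ_k (−1)ᵏ h^{k,0}(Y) = 1 + (−1)^m C(d−1, m+1)`, `p_a(Y) = (−1)^m (χ − 1) = C(d−1, m+1)` -/

section ArithmeticGenus

/-- **`χ(Y) := Σ_{k ≤ m} (−1)ᵏ h^{k,0}(Hᵏ(Y)) = 1 + (−1)^m C(d−1, m+1)`** for a smooth hypersurface `Y ⊂ ℙ^{m+1}_ℂ` of degree `d`, `m ≥ 1`: only `h^{0,0} = 1` and `h^{m,0} = C(d−1, m+1)` (the geometric genus,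
(17.3.1)) contribute (§1). [cite: Arapura2012, §17.3 (17.3.1) (PDF p. 249)] [cite: Hartshorne1977, I Exercise 7.2 (c) (PDF p. 73) and III Exercise 5.5 (c)–(d) (PDF p. 288)] [cite: Hirzebruch1966, Introduction 0.1] -/
theorem arithGenus_eq (hYh : IsSmoothHypersurface m d Y) (hm : 1 ≤ m) (hHD : exists_isReal_hodgeModel) (hX : IsSmoothProjective m Y) :
    ∑ k ∈ range (m + 1), (-1 : ℤ) ^ k * ((BettiUniverse.hodge hHD hX k).hodgeNumber k 0 : ℤ) = 1 + (-1 : ℤ) ^ m * ((d - 1).choose (m + 1) : ℕ) := by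
  obtain ⟨m', rfl⟩ : ∃ m', m = m' + 1 := ⟨m - 1, by omega⟩
  rw [Finset.sum_range_succ, Finset.sum_range_succ', Finset.sum_eq_zero fun k hk ↦ ?_]
  · have h0 := BettiUniverse.hodgeNumber_hodge_zero_zero hHD hX
    have hm' := hYh.hodgeNumber_hodge_top_zero_eq_choose hm hHD hX
    push_cast at h0 hm' ⊢
    rw [h0, hm']
    ring
  · have hk' := Finset.mem_range.1 hk
    have h := hYh.hodgeNumber_hodge_fst_zero_eq_zero_of_ne_middle hHD hX (k := k + 1) (by omega) (by omega)
    rw [h, Nat.cast_zero, mul_zero]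

/-- **Severi–Hartshorne: `p_a(Y) = (−1)^m (χ(Y) − 1) = C(d−1, m+1)`** — «if `H` is a hypersurface of degree `d` in `ℙⁿ`, then `p_a(H) = C(d−1, n)`» (here `n = m + 1`), the Hodge-theoretic count agreeing with the
Hilbert-polynomial arithmetic genus of the tree's `arithGenus_hypersurface` (file `ProjectiveHypersurfaceHilbertPolynomial`). [cite: Hartshorne1977, I Exercise 7.2 (c) (PDF p. 73), III Exercise 5.3 (PDF p. 287) and III Exercise 5.5 (d) (PDF p. 288)]
[cite: Arapura2012, §17.3 (17.3.1) (PDF p. 249)] -/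
theorem arithGenusSeveri_eq_choose (hYh : IsSmoothHypersurface m d Y) (hm : 1 ≤ m) (hHD : exists_isReal_hodgeModel) (hX : IsSmoothProjective m Y) :
    (-1 : ℤ) ^ m * (∑ k ∈ range (m + 1), (-1 : ℤ) ^ k * ((BettiUniverse.hodge hHD hX k).hodgeNumber k 0 : ℤ) - 1) = ((d - 1).choose (m + 1) : ℕ) := by
  rw [hYh.arithGenus_eq hm hHD hX, add_sub_cancel_left, ← mul_assoc, ← pow_add, ← two_mul, pow_mul, neg_one_sq, one_pow, one_mul]

/-- **Fano and borderline hypersurfaces (`d ≤ m + 1`): `χ(Y) = 1`** (`h^{k,0} = 0` for all `k > 0`). [cite: Arapura2012, §17.3 (17.3.1) (PDF p. 249)] [cite: Hartshorne1977, I Exercise 7.2 (c) (PDF p. 73)] -/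
theorem arithGenus_eq_one_of_le (hYh : IsSmoothHypersurface m d Y) (hm : 1 ≤ m) (hd : d ≤ m + 1) (hHD : exists_isReal_hodgeModel) (hX : IsSmoothProjective m Y) :
    ∑ k ∈ range (m + 1), (-1 : ℤ) ^ k * ((BettiUniverse.hodge hHD hX k).hodgeNumber k 0 : ℤ) = 1 := by
  rw [hYh.arithGenus_eq hm hHD hX, Nat.choose_eq_zero_of_lt (by omega), Nat.cast_zero, mul_zero, add_zero]

/-- **Calabi–Yau hypersurfaces (`d = m + 2`): `χ(Y) = 1 + (−1)^m`** (`p_g = 1`; `0` for a quintic threefold, `2` for a quartic surface or a sextic fourfold). [cite: Arapura2012, §17.3 (17.3.1) (PDF p. 249)]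
[cite: Hartshorne1977, I Exercise 7.2 (c) (PDF p. 73)] -/
theorem arithGenus_eq_of_eq_add_two (hYh : IsSmoothHypersurface m d Y) (hm : 1 ≤ m) (hd : d = m + 2) (hHD : exists_isReal_hodgeModel) (hX : IsSmoothProjective m Y) :
    ∑ k ∈ range (m + 1), (-1 : ℤ) ^ k * ((BettiUniverse.hodge hHD hX k).hodgeNumber k 0 : ℤ) = 1 + (-1 : ℤ) ^ m := by
  rw [hYh.arithGenus_eq hm hHD hX, hd, show m + 2 - 1 = m + 1 by omega, Nat.choose_self, Nat.cast_one, mul_one]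

/-- **Surfaces `S_d ⊂ ℙ³`: `χ(𝒪_{S_d}) = 1 − q + p_g = 1 + C(d−1, 3)`** (`1, 1, 1, 2, 5, 11, …` for `d = 1, 2, 3, 4, 5, 6`). [cite: Hartshorne1977, I Exercise 7.2 (c) (PDF p. 73) and III Exercise 5.5 (PDF p. 288)]
[cite: Arapura2012, §17.3 (17.3.1) (PDF p. 249)] -/
theorem arithGenus_surface (hS : IsSmoothHypersurface 2 d S) (hHD : exists_isReal_hodgeModel) (hX : IsSmoothProjective 2 S) :
    ∑ k ∈ range (2 + 1), (-1 : ℤ) ^ k * ((BettiUniverse.hodge hHD hX k).hodgeNumber k 0 : ℤ) = 1 + ((d - 1).choose 3 : ℕ) := by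
  rw [hS.arithGenus_eq (by norm_num) hHD hX]
  norm_num

/-- `χ(𝒪_S) = 2` for a smooth quartic surface (the K3 pattern `q = 0`, `p_g = 1`). [cite: Huybrechts2016K3, Ch. 1 §2.3] [cite: Hartshorne1977, I Exercise 7.2 (c) (PDF p. 73)] -/
theorem arithGenus_quarticSurface (hS : IsSmoothHypersurface 2 4 S) (hHD : exists_isReal_hodgeModel) (hX : IsSmoothProjective 2 S) :
    ∑ k ∈ range (2 + 1), (-1 : ℤ) ^ k * ((BettiUniverse.hodge hHD hX k).hodgeNumber k 0 : ℤ) = 2 := by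
  rw [hS.arithGenus_surface hHD hX]
  norm_num [Nat.choose]

/-- `χ(𝒪_Y) = 0` for a smooth quintic threefold (`h^{0,0} − h^{1,0} + h^{2,0} − h^{3,0} = 1 − 0 + 0 − 1`). [cite: Arapura2012, §17.3 (17.3.1) (PDF p. 249)] [cite: Hartshorne1977, I Exercise 7.2 (c) (PDF p. 73)] -/
theorem arithGenus_quinticThreefold (hYh : IsSmoothHypersurface 3 5 Y) (hHD : exists_isReal_hodgeModel) (hX : IsSmoothProjective 3 Y) :
    ∑ k ∈ range (3 + 1), (-1 : ℤ) ^ k * ((BettiUniverse.hodge hHD hX k).hodgeNumber k 0 : ℤ) = 0 := by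
  rw [hYh.arithGenus_eq_of_eq_add_two (by norm_num) rfl hHD hX]
  norm_num

/-- `χ(𝒪_Y) = 1` for a smooth cubic threefold and for a smooth cubic fourfold (Fano). [cite: Arapura2012, §17.3 (17.3.1) (PDF p. 249)] [cite: Hartshorne1977, I Exercise 7.2 (c) (PDF p. 73)] -/
theorem arithGenus_cubic_eq_one (hYh : IsSmoothHypersurface m 3 Y) (hm : 2 ≤ m) (hHD : exists_isReal_hodgeModel) (hX : IsSmoothProjective m Y) :
    ∑ k ∈ range (m + 1), (-1 : ℤ) ^ k * ((BettiUniverse.hodge hHD hX k).hodgeNumber k 0 : ℤ) = 1 :=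
  hYh.arithGenus_eq_one_of_le (by omega) (by omega) hHD hX

end ArithmeticGenus

/-! ### §3 Holomorphic forms, irregularity, geometric genus and arithmetic genus of a product `Y × Z` with a smooth hypersurface `Y` -/

section Products

/-- **Below the middle all holomorphic forms on `Y × Z` come from `Z`: `h^{k,0}(Hᵏ(Y ⊗ Z)) = h^{k,0}(Hᵏ(Z))` for `k < dim Y`** (in `Σ_i h^{i,0}(Y) h^{k−i,0}(Z)` only `i = 0` survives; any smooth-projective structure on `Y × Z`).
[cite: VoisinHodgeI2002, §11.3.3 Thm. 11.38 (PDF p. 236)] [cite: VoisinHodgeII2003, §1.2.3 Cor. 1.24 (PDF p. 62)] -/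
theorem hodgeNumber_hodge_fst_zero_tensor_of_lt (hYh : IsSmoothHypersurface m e Y) (hHD : exists_isReal_hodgeModel) (hZ : IsSmoothProjective n Z) (hYZ : IsSmoothProjective l (Y ⊗ Z)) {k : ℕ}
    (hk : k < m) : (BettiUniverse.hodge hHD hYZ k).hodgeNumber k 0 = (BettiUniverse.hodge hHD hZ k).hodgeNumber k 0 := by
  haveI : HodgeTensorFacts.{0, 0} := hodgeTensorFacts_holds
  rw [BettiUniverse.hodgeNumber_hodge_tensor_fst_zero hHD hYh.1 hZ hYZ k, Finset.sum_eq_single_of_mem 0 (Finset.mem_range.2 (by omega))]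
  · have h0 : (BettiUniverse.hodge hHD hYh.1 0).hodgeNumber ((0 : ℕ) : ℤ) 0 = 1 := BettiUniverse.hodgeNumber_hodge_zero_zero hHD hYh.1
    rw [h0, one_mul, Nat.sub_zero]
  · intro i hi hi0
    have hi' := Finset.mem_range.1 hi
    rw [hYh.hodgeNumber_hodge_fst_zero_eq_zero_of_ne_middle hHD hYh.1 (k := i) (by omega) (by omega), zero_mul]

/-- **From the middle on: `h^{k,0}(Hᵏ(Y ⊗ Z)) = h^{k,0}(Hᵏ(Z)) + C(d−1, m+1) · h^{k−m,0}(H^{k−m}(Z))` for `m ≤ k`, `m ≥ 1`** (the terms `i = 0` and `i = m`). [cite: VoisinHodgeI2002, §11.3.3 Thm. 11.38 (PDF p. 236)]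
[cite: Arapura2012, §17.3 (17.3.1) (PDF p. 249)] -/
theorem hodgeNumber_hodge_fst_zero_tensor_of_le (hYh : IsSmoothHypersurface m d Y) (hm : 1 ≤ m) (hHD : exists_isReal_hodgeModel) (hZ : IsSmoothProjective n Z) (hYZ : IsSmoothProjective l (Y ⊗ Z))
    {k : ℕ} (hk : m ≤ k) :
    (BettiUniverse.hodge hHD hYZ k).hodgeNumber k 0 = (BettiUniverse.hodge hHD hZ k).hodgeNumber k 0 + (d - 1).choose (m + 1) * (BettiUniverse.hodge hHD hZ (k - m)).hodgeNumber (k - m : ℕ) 0 := by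
  haveI : HodgeTensorFacts.{0, 0} := hodgeTensorFacts_holds
  rw [BettiUniverse.hodgeNumber_hodge_tensor_fst_zero hHD hYh.1 hZ hYZ k,
    Finset.sum_eq_add_of_mem (0 : ℕ) m (Finset.mem_range.2 (by omega)) (Finset.mem_range.2 (by omega)) (by omega)]
  · have h0 : (BettiUniverse.hodge hHD hYh.1 0).hodgeNumber ((0 : ℕ) : ℤ) 0 = 1 := BettiUniverse.hodgeNumber_hodge_zero_zero hHD hYh.1
    rw [h0, one_mul, Nat.sub_zero, hYh.hodgeNumber_hodge_top_zero_eq_choose hm hHD hYh.1]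
  · intro i hi ⟨hi0, him⟩
    have hi' := Finset.mem_range.1 hi
    by_cases hmi : m < i
    · rw [show (BettiUniverse.hodge hHD hYh.1 i).hodgeNumber (i : ℕ) 0 = 0 by exact_mod_cast BettiUniverse.hodgeNumber_hodge_eq_zero_of_lt_fst hHD hYh.1 (k := i) (p := i) (q := 0) rfl hmi,
        zero_mul]
    · rw [hYh.hodgeNumber_hodge_fst_zero_eq_zero_of_ne_middle hHD hYh.1 (k := i) (by omega) (by omega), zero_mul]

/-- **The geometric genus of `Y × Z`: `p_g(Y × Z) = h^{m+n,0} = C(d−1, m+1) · p_g(Z)`** (`p_g` is multiplicative, the tree's `BettiUniverse.hodgeNumber_hodge_tensor_top_zero`, and `p_g(Y) = C(d−1, m+1)`).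
[cite: Hartshorne1977, II Exercise 8.3 (b)–(c) (PDF p. 239) and I Exercise 7.2 (c) (PDF p. 73)] [cite: Arapura2012, §17.3 (17.3.1) (PDF p. 249)] -/
theorem hodgeNumber_hodge_top_zero_tensor (hYh : IsSmoothHypersurface m d Y) (hm : 1 ≤ m) (hHD : exists_isReal_hodgeModel) (hZ : IsSmoothProjective n Z) (hYZ : IsSmoothProjective l (Y ⊗ Z)) :
    (BettiUniverse.hodge hHD hYZ (m + n)).hodgeNumber (m + n : ℕ) 0 = (d - 1).choose (m + 1) * (BettiUniverse.hodge hHD hZ n).hodgeNumber n 0 := by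
  haveI : HodgeTensorFacts.{0, 0} := hodgeTensorFacts_holds
  rw [BettiUniverse.hodgeNumber_hodge_tensor_top_zero hHD hYh.1 hZ hYZ, hYh.hodgeNumber_hodge_top_zero_eq_choose hm hHD hYh.1]

/-- **`p_g(Y × Z) = 0` for a hypersurface factor of degree `d ≤ m + 1`** (no top form on `Y`). [cite: Hartshorne1977, II Exercise 8.3 (b)–(c) (PDF p. 239)] [cite: Arapura2012, §17.3 (17.3.1) (PDF p. 249)] -/
theorem hodgeNumber_hodge_top_zero_tensor_eq_zero_of_le (hYh : IsSmoothHypersurface m d Y) (hm : 1 ≤ m) (hd : d ≤ m + 1) (hHD : exists_isReal_hodgeModel) (hZ : IsSmoothProjective n Z)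
    (hYZ : IsSmoothProjective l (Y ⊗ Z)) : (BettiUniverse.hodge hHD hYZ (m + n)).hodgeNumber (m + n : ℕ) 0 = 0 := by
  rw [hYh.hodgeNumber_hodge_top_zero_tensor hm hHD hZ hYZ, Nat.choose_eq_zero_of_lt (by omega), zero_mul]

/-- **`p_g(Y × Z) = p_g(Z)` for a Calabi–Yau hypersurface factor (`d = m + 2`, `p_g(Y) = 1`).** [cite: Hartshorne1977, II Exercise 8.3 (b)–(c) (PDF p. 239)] [cite: Arapura2012, §17.3 (17.3.1) (PDF p. 249)] -/
theorem hodgeNumber_hodge_top_zero_tensor_of_eq_add_two (hYh : IsSmoothHypersurface m d Y) (hm : 1 ≤ m) (hd : d = m + 2) (hHD : exists_isReal_hodgeModel) (hZ : IsSmoothProjective n Z)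
    (hYZ : IsSmoothProjective l (Y ⊗ Z)) : (BettiUniverse.hodge hHD hYZ (m + n)).hodgeNumber (m + n : ℕ) 0 = (BettiUniverse.hodge hHD hZ n).hodgeNumber n 0 := by
  rw [hYh.hodgeNumber_hodge_top_zero_tensor hm hHD hZ hYZ, hd, show m + 2 - 1 = m + 1 by omega, Nat.choose_self, one_mul]

/-- **The irregularity of `Y × Z` is that of `Z`: `q(Y × Z) = q(Z)`** for a hypersurface `Y` of dimension `m ≥ 2` (`q` is additive and `q(Y) = 0`). [cite: VoisinHodgeII2003, §1.2.3 Cor. 1.24 (PDF p. 62)]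
[cite: Arapura2012, §11.1 Example 11.1.2 (PDF p. 174)] -/
theorem irregularity_tensor (hYh : IsSmoothHypersurface m e Y) (hm : 2 ≤ m) (hHD : exists_isReal_hodgeModel) (hZ : IsSmoothProjective n Z) (hYZ : IsSmoothProjective l (Y ⊗ Z)) :
    (BettiUniverse.hodge hHD hYZ 1).hodgeNumber 1 0 = (BettiUniverse.hodge hHD hZ 1).hodgeNumber 1 0 := by
  exact_mod_cast hYh.hodgeNumber_hodge_fst_zero_tensor_of_lt hHD hZ hYZ (k := 1) (by omega)

/-- `q(Z × Y) = q(Z)`, the hypersurface (`dim ≥ 2`) on the right. [cite: VoisinHodgeII2003, §1.2.3 Cor. 1.24 (PDF p. 62)] [cite: Arapura2012, §11.1 Example 11.1.2 (PDF p. 174)] -/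
theorem irregularity_tensor_right (hYh : IsSmoothHypersurface m e Y) (hm : 2 ≤ m) (hHD : exists_isReal_hodgeModel) (hZ : IsSmoothProjective n Z) (hZY : IsSmoothProjective l (Z ⊗ Y)) :
    (BettiUniverse.hodge hHD hZY 1).hodgeNumber 1 0 = (BettiUniverse.hodge hHD hZ 1).hodgeNumber 1 0 := by
  haveI : HodgeTensorFacts.{0, 0} := hodgeTensorFacts_holds
  have h : (BettiUniverse.hodge hHD hYh.1 1).hodgeNumber 1 0 = 0 := by
    exact_mod_cast hYh.hodgeNumber_hodge_fst_zero_eq_zero_of_ne_middle hHD hYh.1 (k := 1) one_pos (by omega)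
  rw [BettiUniverse.hodgeNumber_hodge_one_tensor hHD hZ hYh.1 hZY, h, add_zero]

/-- **`h^{2,0}(Y × Z) = h^{2,0}(Z)` for a hypersurface `Y` of dimension `m ≥ 3`** (`p_g(Y ⊗ Z) = h^{2,0}(Y) + q(Y) q(Z) + h^{2,0}(Z)` with `h^{2,0}(Y) = q(Y) = 0`) — so the «`p_g · h^{ν+1,ν−1} = 0`» hypotheses of the
seat's product criteria read the same for `Y × Z` as for `Z`. [cite: VoisinHodgeI2002, §11.3.3 Thm. 11.38 (PDF p. 236)] [cite: VoisinHodgeII2003, §1.2.3 Cor. 1.24 (PDF p. 62)] -/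
theorem hodgeNumber_hodge_two_zero_tensor (hYh : IsSmoothHypersurface m e Y) (hm : 3 ≤ m) (hHD : exists_isReal_hodgeModel) (hZ : IsSmoothProjective n Z) (hYZ : IsSmoothProjective l (Y ⊗ Z)) :
    (BettiUniverse.hodge hHD hYZ 2).hodgeNumber 2 0 = (BettiUniverse.hodge hHD hZ 2).hodgeNumber 2 0 := by
  exact_mod_cast hYh.hodgeNumber_hodge_fst_zero_tensor_of_lt hHD hZ hYZ (k := 2) (by omega)

/-- **A surface `S_d ⊂ ℙ³` times `Z`: `h^{2,0}(S_d × Z) = C(d−1, 3) + h^{2,0}(Z)`** (`q(S_d) = 0`, `p_g(S_d) = C(d−1,3)`). [cite: VoisinHodgeI2002, §11.3.3 Thm. 11.38 (PDF p. 236)]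
[cite: Arapura2012, §17.3 (17.3.1) (PDF p. 249) and §11.1 Example 11.1.2 (PDF p. 174)] -/
theorem hodgeNumber_hodge_two_zero_surface_tensor (hS : IsSmoothHypersurface 2 d S) (hHD : exists_isReal_hodgeModel) (hZ : IsSmoothProjective n Z) (hSZ : IsSmoothProjective l (S ⊗ Z)) :
    (BettiUniverse.hodge hHD hSZ 2).hodgeNumber 2 0 = (d - 1).choose 3 + (BettiUniverse.hodge hHD hZ 2).hodgeNumber 2 0 := by
  have h := hS.hodgeNumber_hodge_fst_zero_tensor_of_le (by norm_num) hHD hZ hSZ (k := 2) le_rfl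
  have h0 : (BettiUniverse.hodge hHD hZ (2 - 2)).hodgeNumber ((2 - 2 : ℕ) : ℤ) 0 = 1 := BettiUniverse.hodgeNumber_hodge_zero_zero hHD hZ
  have h' : (BettiUniverse.hodge hHD hSZ 2).hodgeNumber 2 0 = (BettiUniverse.hodge hHD hZ 2).hodgeNumber 2 0 + (d - 1).choose 3 := by
    rw [h0, mul_one] at h
    exact_mod_cast h
  rw [h', add_comm]

/-- **The arithmetic genus of `Y × Z`: `χ(Y × Z) = (1 + (−1)^m C(d−1, m+1)) · χ(Z)`** («the arithmetic genus … behave[s] multiplicatively», the tree's `BettiUniverse.arithGenus_tensor`).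
[cite: Hirzebruch1966, Introduction 0.1] [cite: Hartshorne1977, I Exercise 7.2 (c), (e) (PDF p. 73–74) and III Exercise 5.3 (PDF p. 287)] -/
theorem arithGenus_tensor (hYh : IsSmoothHypersurface m d Y) (hm : 1 ≤ m) (hHD : exists_isReal_hodgeModel) (hZ : IsSmoothProjective n Z) (hYZ : IsSmoothProjective l (Y ⊗ Z)) :
    ∑ k ∈ range (m + n + 1), (-1 : ℤ) ^ k * ((BettiUniverse.hodge hHD hYZ k).hodgeNumber k 0 : ℤ) =
      (1 + (-1 : ℤ) ^ m * ((d - 1).choose (m + 1) : ℕ)) * ∑ j ∈ range (n + 1), (-1 : ℤ) ^ j * ((BettiUniverse.hodge hHD hZ j).hodgeNumber j 0 : ℤ) := by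
  haveI : HodgeTensorFacts.{0, 0} := hodgeTensorFacts_holds
  rw [BettiUniverse.arithGenus_tensor hHD hYh.1 hZ hYZ, hYh.arithGenus_eq hm hHD hYh.1]

/-- **`χ(Y × Z) = χ(Z)` for a hypersurface factor of degree `d ≤ m + 1`** (`χ(Y) = 1`). [cite: Hirzebruch1966, Introduction 0.1] [cite: Hartshorne1977, I Exercise 7.2 (c), (e) (PDF p. 73–74)] -/
theorem arithGenus_tensor_of_le (hYh : IsSmoothHypersurface m d Y) (hm : 1 ≤ m) (hd : d ≤ m + 1) (hHD : exists_isReal_hodgeModel) (hZ : IsSmoothProjective n Z) (hYZ : IsSmoothProjective l (Y ⊗ Z)) :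
    ∑ k ∈ range (m + n + 1), (-1 : ℤ) ^ k * ((BettiUniverse.hodge hHD hYZ k).hodgeNumber k 0 : ℤ) = ∑ j ∈ range (n + 1), (-1 : ℤ) ^ j * ((BettiUniverse.hodge hHD hZ j).hodgeNumber j 0 : ℤ) := by
  rw [hYh.arithGenus_tensor hm hHD hZ hYZ, Nat.choose_eq_zero_of_lt (by omega), Nat.cast_zero, mul_zero, add_zero, one_mul]

/-- **Hartshorne's Exercise I.7.2 (e) for a hypersurface factor: `p_a(Y × Z) = p_a(Y) p_a(Z) + (−1)ⁿ p_a(Y) + (−1)^m p_a(Z)`** with `p_a(Y) = C(d−1, m+1)`, `p_a = (−1)^{dim}(χ − 1)`.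
[cite: Hartshorne1977, I Exercise 7.2 (c), (e) (PDF p. 73–74) and III Exercise 5.3 (PDF p. 287)] [cite: Hirzebruch1966, Introduction 0.1] -/
theorem arithGenusSeveri_tensor (hYh : IsSmoothHypersurface m d Y) (hm : 1 ≤ m) (hHD : exists_isReal_hodgeModel) (hZ : IsSmoothProjective n Z) (hYZ : IsSmoothProjective l (Y ⊗ Z)) :
    (-1 : ℤ) ^ (m + n) * (∑ k ∈ range (m + n + 1), (-1 : ℤ) ^ k * ((BettiUniverse.hodge hHD hYZ k).hodgeNumber k 0 : ℤ) - 1) =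
      ((d - 1).choose (m + 1) : ℕ) * ((-1 : ℤ) ^ n * (∑ j ∈ range (n + 1), (-1 : ℤ) ^ j * ((BettiUniverse.hodge hHD hZ j).hodgeNumber j 0 : ℤ) - 1)) +
        (-1 : ℤ) ^ n * ((d - 1).choose (m + 1) : ℕ) + (-1 : ℤ) ^ m * ((-1 : ℤ) ^ n * (∑ j ∈ range (n + 1), (-1 : ℤ) ^ j * ((BettiUniverse.hodge hHD hZ j).hodgeNumber j 0 : ℤ) - 1)) := by
  rw [hYh.arithGenus_tensor hm hHD hZ hYZ, pow_add]
  have hsq : ((-1 : ℤ) ^ m) ^ 2 = 1 := by rw [← pow_mul, mul_comm, pow_mul, neg_one_sq, one_pow]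
  linear_combination ((-1 : ℤ) ^ n * (((d - 1).choose (m + 1) : ℕ) : ℤ) * ∑ j ∈ range (n + 1), (-1 : ℤ) ^ j * ((BettiUniverse.hodge hHD hZ j).hodgeNumber j 0 : ℤ)) * hsq

/-- **Two smooth hypersurfaces: `χ(Y × Y′) = (1 + (−1)^m C(d−1, m+1)) (1 + (−1)^{m′} C(d′−1, m′+1))`.** [cite: Hirzebruch1966, Introduction 0.1] [cite: Hartshorne1977, I Exercise 7.2 (c), (e) (PDF p. 73–74)] -/
theorem arithGenus_tensor_hypersurface {d' : ℕ} {Y' : SchemeOver ℂ} (hYh : IsSmoothHypersurface m d Y) (hm : 1 ≤ m) (hYh' : IsSmoothHypersurface n d' Y') (hn : 1 ≤ n) (hHD : exists_isReal_hodgeModel)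
    (hYY' : IsSmoothProjective l (Y ⊗ Y')) :
    ∑ k ∈ range (m + n + 1), (-1 : ℤ) ^ k * ((BettiUniverse.hodge hHD hYY' k).hodgeNumber k 0 : ℤ) =
      (1 + (-1 : ℤ) ^ m * ((d - 1).choose (m + 1) : ℕ)) * (1 + (-1 : ℤ) ^ n * ((d' - 1).choose (n + 1) : ℕ)) := by
  rw [hYh.arithGenus_tensor hm hHD hYh'.1 hYY', hYh'.arithGenus_eq hn hHD hYh'.1]

/-- **The geometric genus of a product of two hypersurfaces: `p_g(Y × Y′) = C(d−1, m+1) · C(d′−1, m′+1)`.** [cite: Hartshorne1977, II Exercise 8.3 (b)–(c) (PDF p. 239)] [cite: Arapura2012, §17.3 (17.3.1) (PDF p. 249)] -/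
theorem hodgeNumber_hodge_top_zero_tensor_hypersurface {d' : ℕ} {Y' : SchemeOver ℂ} (hYh : IsSmoothHypersurface m d Y) (hm : 1 ≤ m) (hYh' : IsSmoothHypersurface n d' Y') (hn : 1 ≤ n)
    (hHD : exists_isReal_hodgeModel) (hYY' : IsSmoothProjective l (Y ⊗ Y')) :
    (BettiUniverse.hodge hHD hYY' (m + n)).hodgeNumber (m + n : ℕ) 0 = (d - 1).choose (m + 1) * (d' - 1).choose (n + 1) := by
  rw [hYh.hodgeNumber_hodge_top_zero_tensor hm hHD hYh'.1 hYY', hYh'.hodgeNumber_hodge_top_zero_eq_choose hn hHD hYh'.1]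

end Products

end Literature.AlgebraicGeometry.Motives.IsSmoothHypersurface

end
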